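import Summits.AnomalousDissipation.AnomalousDissipation.Theses.TaylorCertificates

/-!
# Crux `TaylorCertificates.TaylorCertificatePair` (stmt-AnomalousDissipation-13037) — crux-ideate round 2, ideator 5

Typed first lemmas for the two idea cards of this seat (STATEMENTS only; `lean check` must be rc 0).

* Card `taylor-trapping-barrier`: the CEILING species is replaced by a BARRIER (forward-invariance)
  certificate `V(u) = Ψ(u) + ‖u‖²` (`Ψ` cylindrical, Taylor band-limited) whose generator is `≤ 0` only on the
  COLLAR `{|V| ≤ η}`; the certified object is a ν-uniform trapping region `{V ≤ 0} ∋ 0` of energy radius `E`.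
  `BarrierTransfer` (support, provable-now candidate) moves it onto every Leray–Hopf flow from rest:
  `sup_t ‖U t‖² ≤ E`.  The FLOOR then only has to hold on the O(1) ball `{‖u‖² ≤ E}` (`FloorTransferBall`).
  `TaylorTrapFloorPair` is the repaired crux shape; `trapFloorPair_floor` records that it contains a Taylor floor.
* Card `odd-clock-cascade`: `floor_parity` — a floor certificate on a symmetric domain is carried by the ODD part of
  its profile: averaging FLOOR at `u` and `−u` leaves the even-core inequality `EvenCoreFloor`.
-/

noncomputable section

open MeasureTheory

namespace Summit.AnomalousDissipation.AnomalousDissipation.Cruxes.TaylorCertificatePair.TrappingBarrier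

open Literature.Analysis.FunctionSpaces Literature.Analysis.FluidPDE
open Summit.AnomalousDissipation.AnomalousDissipation.Theses.TaylorCertificates

local notation "𝕋³" => UnitAddTorus (Fin 3)
local notation "E³" => EuclideanSpace ℝ (Fin 3)
local notation "H³" => Torus.energySpace (Fin 3)
local notation "L2³" => MeasureTheory.Lp (EuclideanSpace ℝ (Fin 3)) 2
  (MeasureTheory.volume : MeasureTheory.Measure (UnitAddTorus (Fin 3)))

/-- The barrier functional `V(u) = Ψ(u) + ‖u‖²` of a cylindrical `Ψ` (energy weight normalised to `1`). -/
def barrierValue (Ψ : Torus.CylindricalTest (Fin 3)) (u : H³) : ℝ :=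
  Ψ.eval u + ‖u‖ ^ 2

/-- The generator of `V = Ψ + ‖·‖²` along `NS_ν(f)`, written for `u ∈ H` with finite enstrophy:
`⟨F(u), Ψ'(u)⟩ + 2((u,f) − ν‖∇u‖²)` (chain rule for `Ψ`, energy inequality for `‖u‖²`). -/
def barrierGenerator (ν : ℝ) (f : 𝕋³ → E³) (Ψ : Torus.CylindricalTest (Fin 3)) (u : H³) : ℝ :=
  Torus.nsGeneratorPairing ν f u (Ψ.grad u) +
    2 * (Torus.pairing (u : L2³) f - ν * (Torus.eGradNormSq ((u : L2³) : 𝕋³ → E³)).toReal)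

/-- SUPPORT (provable-now candidate) **BarrierTransfer**: forward invariance of the sublevel set `{V ≤ 0}` of an
energy-cylindrical barrier along a global Leray–Hopf solution from rest.  Hypotheses: `V(0) = Ψ(0) < 0`; the
generator is `≤ 0` on the collar `{|V| ≤ η}` at finite-enstrophy states; `{V ≤ η}` lies in the ball `‖u‖² ≤ E`.
Conclusion: the `H`-lift of the flow never leaves the ball.  Proof sketch: `t ↦ Ψ(U t)` is continuous with
`Ψ(U t) − Ψ(U s) = ∫ₛᵗ ⟨F, Ψ'⟩` (`IsGlobalLerayHopf.cylindrical_eval_sub_eq_integral`), `‖U t‖²` is lower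
semicontinuous with `‖U t‖² ≤ ‖U s‖² + 2∫ₛᵗ P` for a.e. `s` (`energy_ineq_ae`) and from `s = 0`; at the first exit
time `t₂` one has `V(U t) ≤ η` just after `t₂`, and a generic base point `σ` either in `{V < −η}` (then
`V(U t) ≤ −η + ∫|G| < 0`) or with `{V < −η}` null on `[σ,t]` (then `V(U t) ≤ V(U σ) ≤ 0`) contradicts `V(U t) > 0`. -/
def BarrierTransfer : Prop :=
  ∀ (ν η E : ℝ) (f : 𝕋³ → E³) (u : ℝ → 𝕋³ → E³) (U : ℝ → H³) (Ψ : Torus.CylindricalTest (Fin 3)),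
    0 < ν → 0 < η → Torus.IsSmooth f →
    Ψ.eval 0 < 0 →
    (∀ v : H³, barrierValue Ψ v ≤ η → ‖v‖ ^ 2 ≤ E) →
    (∀ v : H³, Torus.eGradNormSq ((v : L2³) : 𝕋³ → E³) ≠ ⊤ → |barrierValue Ψ v| ≤ η →
      barrierGenerator ν f Ψ v ≤ 0) →
    Torus.IsGlobalLerayHopf ν (fun _ => f) 0 u →
    (∀ t, 0 ≤ t → ((U t : L2³) : 𝕋³ → E³) =ᵐ[volume] u t) →
    ∀ t, 0 ≤ t → ‖U t‖ ^ 2 ≤ E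

/-- SUPPORT (provable-now candidate) **FloorTransferBall**: the FLOOR half of `CertificateTransfer`, with the
certificate required only on the O(1) ball `‖v‖² ≤ ρ` in which the flow is known to stay (supplied by the barrier). -/
def FloorTransferBall : Prop :=
  ∀ (ν ε₀ ρ θ₁ : ℝ) (f u₀ : 𝕋³ → E³) (u : ℝ → 𝕋³ → E³) (U : ℝ → H³) (Φ₁ : Torus.CylindricalTest (Fin 3)),
    0 < ν → Torus.IsSmooth f → θ₁ ≤ 0 →
    (∀ v : H³, let vf : 𝕋³ → E³ := ((v : L2³) : 𝕋³ → E³)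
      let D : ℝ := ν * (Torus.eGradNormSq vf).toReal
      let P : ℝ := Torus.pairing (v : L2³) f - D
      Torus.eGradNormSq vf ≠ ⊤ → ‖v‖ ^ 2 ≤ ρ →
        ε₀ ≤ D + Torus.nsGeneratorPairing ν f v (Φ₁.grad v) + 2 * θ₁ * P) →
    Torus.IsGlobalLerayHopf ν (fun _ => f) u₀ u →
    (∀ t, 0 ≤ t → ((U t : L2³) : 𝕋³ → E³) =ᵐ[volume] u t) →
    (∀ t, 0 ≤ t → ‖U t‖ ^ 2 ≤ ρ) →
    ε₀ ≤ meanDissipation ν u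

/-- The barrier clause at viscosity `ν` for force `f`, radius `E`, collar `η`, Taylor constant `C`:
a band-limited cylindrical `Ψ` (test fields of degree `≤ N ≤ Cν^{-1/2}`) with `Ψ(0) < 0`, `{V ≤ η} ⊆ {‖u‖² ≤ E}`
and generator `≤ 0` on the collar. -/
def BarrierClause (ν E η C : ℝ) (f : 𝕋³ → E³) : Prop :=
  ∃ (N : ℕ) (Ψ : Torus.CylindricalTest (Fin 3)),
    (N : ℝ) ≤ C * ν ^ (-(1 / 2 : ℝ)) ∧ (∀ i, Torus.fourierTruncate N (Ψ.g i) = Ψ.g i) ∧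
    Ψ.eval 0 < 0 ∧
    (∀ v : H³, barrierValue Ψ v ≤ η → ‖v‖ ^ 2 ≤ E) ∧
    ∀ v : H³, Torus.eGradNormSq ((v : L2³) : 𝕋³ → E³) ≠ ⊤ → |barrierValue Ψ v| ≤ η →
      barrierGenerator ν f Ψ v ≤ 0

/-- The floor clause at viscosity `ν` on the ball `‖u‖² ≤ E`, in the Taylor class (degree `≤ N ≤ Cν^{-1/2}`,
weight `−Θ ≤ θ₁ ≤ 0`). -/
def FloorClause (ν ε₀ E C Θ : ℝ) (f : 𝕋³ → E³) : Prop :=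
  ∃ (N : ℕ) (Φ₁ : Torus.CylindricalTest (Fin 3)) (θ₁ : ℝ),
    (N : ℝ) ≤ C * ν ^ (-(1 / 2 : ℝ)) ∧ (∀ i, Torus.fourierTruncate N (Φ₁.g i) = Φ₁.g i) ∧ -Θ ≤ θ₁ ∧ θ₁ ≤ 0 ∧
    ∀ v : H³, let vf : 𝕋³ → E³ := ((v : L2³) : 𝕋³ → E³)
      let D : ℝ := ν * (Torus.eGradNormSq vf).toReal
      let P : ℝ := Torus.pairing (v : L2³) f - D
      Torus.eGradNormSq vf ≠ ⊤ → ‖v‖ ^ 2 ≤ E →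
        ε₀ ≤ D + Torus.nsGeneratorPairing ν f v (Φ₁.grad v) + 2 * θ₁ * P

/-- CANDIDATE REPAIRED CRUX **TaylorTrapFloorPair** (card `taylor-trapping-barrier`): one smooth div-free mean-zero
force, one energy radius `E`, such that for every small `ν` the Taylor class carries a trapping BARRIER of radius
`E` from rest and a FLOOR `ε₀` on the ball of radius `E`. -/
def TaylorTrapFloorPair : Prop :=
  ∃ f : 𝕋³ → E³, Torus.IsSmooth f ∧ Torus.IsDivFree f ∧ Torus.HasZeroMean f ∧
    ∃ (ε₀ E η C Θ ν₀ : ℝ), 0 < ε₀ ∧ 0 < η ∧ 0 < ν₀ ∧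
      ∀ ν : ℝ, 0 < ν → ν < ν₀ → BarrierClause ν E η C f ∧ FloorClause ν ε₀ E C Θ f

/-- ZeroDatumLift: Hopf from rest with an `H`-lift (the route's `ZeroDatumLerayHopf` minus the Leray-ball clause,
which the barrier makes redundant). -/
def ZeroDatumLift : Prop :=
  ∀ (ν : ℝ) (f : 𝕋³ → E³), 0 < ν → Torus.IsSmooth f → Torus.HasZeroMean f →
    ∃ (u : ℝ → 𝕋³ → E³) (U : ℝ → H³), Torus.IsGlobalLerayHopf ν (fun _ => f) 0 u ∧
      ∀ t, 0 ≤ t → ((U t : L2³) : 𝕋³ → E³) =ᵐ[volume] u t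

/-- MeanEnergyOfSup: a pathwise energy bound gives the mean-energy bound (limsup of Cesàro means of a function
bounded by `E` a.e.-equal slices; bookkeeping with `meanEnergy`'s junk conventions). -/
def MeanEnergyOfSup : Prop :=
  ∀ (E : ℝ) (u : ℝ → 𝕋³ → E³) (U : ℝ → H³), 0 ≤ E →
    (∀ t, 0 ≤ t → ((U t : L2³) : 𝕋³ → E³) =ᵐ[volume] u t) → (∀ t, 0 ≤ t → ‖U t‖ ^ 2 ≤ E) →
    meanEnergy u ≤ E

/-- The assembly shape of the repaired line (glue for the tenure planner; the deciding theorem would read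
`closes : TaylorTrapFloorPair → BarrierTransfer → FloorTransferBall → ZeroDatumLift → MeanEnergyOfSup → AnomalousDissipation`). -/
def TrapAssembly : Prop :=
  TaylorTrapFloorPair → BarrierTransfer → FloorTransferBall → ZeroDatumLift → MeanEnergyOfSup →
    _root_.AnomalousDissipation

/-- The assembly is pure logic plus `ν_j := ν₀/(j+2)` (same skeleton as the route's `closes`). -/
theorem trapAssembly_holds : TrapAssembly := by
  intro hP hB hF hZ hM
  obtain ⟨f, hfs, hfd, hfz, ε₀, E, η, C, Θ, ν₀, hε₀, hη, hν₀, hcert⟩ := hP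
  have key : ∀ j : ℕ, ∃ u : ℝ → 𝕋³ → E³,
      Torus.IsGlobalLerayHopf (ν₀ / ((j : ℝ) + 2)) (fun _ => f) 0 u ∧
        ε₀ ≤ meanDissipation (ν₀ / ((j : ℝ) + 2)) u ∧ meanEnergy u ≤ E := by
    intro j
    have hj : (0 : ℝ) < (j : ℝ) + 2 := by positivity
    have hνpos : 0 < ν₀ / ((j : ℝ) + 2) := div_pos hν₀ hj
    have hνlt : ν₀ / ((j : ℝ) + 2) < ν₀ := by
      rw [div_lt_iff₀ hj]; nlinarith
    obtain ⟨⟨N, Ψ, -, -, hΨ0, hsub, hgen⟩, ⟨N₁, Φ₁, θ₁, -, -, -, hθ₁, hfloor⟩⟩ := hcert _ hνpos hνlt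
    obtain ⟨u, U, hLH, hU⟩ := hZ _ f hνpos hfs hfz
    have hball : ∀ t, 0 ≤ t → ‖U t‖ ^ 2 ≤ E :=
      hB _ η E f u U Ψ hνpos hη hfs hΨ0 hsub hgen hLH hU
    have hE0 : 0 ≤ E := le_trans (sq_nonneg _) (hball 0 le_rfl)
    exact ⟨u, hLH, hF _ ε₀ E θ₁ f 0 u U Φ₁ hνpos hfs hθ₁ hfloor hLH hU hball, hM E u U hE0 hU hball⟩
  choose u hu using key
  refine ⟨f, hfs, hfd, hfz, fun j => ν₀ / ((j : ℝ) + 2), fun _ => 0, u, fun j => div_pos hν₀ (by positivity), ?_,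
    fun j => (hu j).1, ⟨E, fun j => (hu j).2.2⟩, ε₀, hε₀, fun j => (hu j).2.1⟩
  have h1 : Filter.Tendsto (fun j : ℕ => ((j : ℝ) + 2)⁻¹) Filter.atTop (nhds 0) :=
    tendsto_inv_atTop_zero.comp
      (Filter.tendsto_atTop_add_const_right Filter.atTop (2 : ℝ) tendsto_natCast_atTop_atTop)
  have h2 : Filter.Tendsto (fun j : ℕ => ν₀ * ((j : ℝ) + 2)⁻¹) Filter.atTop (nhds (ν₀ * 0)) := h1.const_mul ν₀
  rw [mul_zero] at h2
  simpa [div_eq_mul_inv] using h2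

/-- The repaired pair contains a Taylor FLOOR on the O(1) ball (bookkeeping: the floor clause is one conjunct). -/
theorem trapFloorPair_floor (h : TaylorTrapFloorPair) :
    ∃ f : 𝕋³ → E³, Torus.IsSmooth f ∧ Torus.IsDivFree f ∧ Torus.HasZeroMean f ∧
      ∃ (ε₀ E C Θ ν₀ : ℝ), 0 < ε₀ ∧ 0 < ν₀ ∧ ∀ ν : ℝ, 0 < ν → ν < ν₀ → FloorClause ν ε₀ E C Θ f := by
  obtain ⟨f, hfs, hfd, hfz, ε₀, E, η, C, Θ, ν₀, hε₀, -, hν₀, h⟩ := h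
  exact ⟨f, hfs, hfd, hfz, ε₀, E, C, Θ, ν₀, hε₀, hν₀, fun ν hν hν' => (h ν hν hν').2⟩

/-! ### Resolution-indexed floor (after reading ideator 4's `truncated-phantom-floor`, same round)

Truncated forced standing flows (convex-integration steady Euler states of the designer's own `f`, truncated at a
quiet scale) kill every pointwise floor whose multipliers are band-limited at `N ≤ Cν^{-1/2}` (conditional on the forced
stationary h-principle).  At resolution `N ≤ Cν^{-β}` the same lever needs phantoms of regularity `> 2 − 1/β`; so the floor
clause is re-indexed by `β ∈ (1/2, 1]` (`β = 3/4`, Kolmogorov, is the recommended successor: its kinematic enemies are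
`C^{2/3+}` quiet standing flows), while the BARRIER keeps Taylor resolution. -/

/-- The floor clause at resolution exponent `β` on the ball `‖u‖² ≤ E` (degree `≤ N ≤ Cν^{-β}`, weight `−Θ ≤ θ₁ ≤ 0`). -/
def FloorClauseAt (β ν ε₀ E C Θ : ℝ) (f : 𝕋³ → E³) : Prop :=
  ∃ (N : ℕ) (Φ₁ : Torus.CylindricalTest (Fin 3)) (θ₁ : ℝ),
    (N : ℝ) ≤ C * ν ^ (-β) ∧ (∀ i, Torus.fourierTruncate N (Φ₁.g i) = Φ₁.g i) ∧ -Θ ≤ θ₁ ∧ θ₁ ≤ 0 ∧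
    ∀ v : H³, let vf : 𝕋³ → E³ := ((v : L2³) : 𝕋³ → E³)
      let D : ℝ := ν * (Torus.eGradNormSq vf).toReal
      let P : ℝ := Torus.pairing (v : L2³) f - D
      Torus.eGradNormSq vf ≠ ⊤ → ‖v‖ ^ 2 ≤ E →
        ε₀ ≤ D + Torus.nsGeneratorPairing ν f v (Φ₁.grad v) + 2 * θ₁ * P

/-- The barrier clause at resolution exponent `βb` (test fields of degree `≤ N ≤ Cν^{-βb}`). -/
def BarrierClauseAt (βb ν E η C : ℝ) (f : 𝕋³ → E³) : Prop :=
  ∃ (N : ℕ) (Ψ : Torus.CylindricalTest (Fin 3)),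
    (N : ℝ) ≤ C * ν ^ (-βb) ∧ (∀ i, Torus.fourierTruncate N (Ψ.g i) = Ψ.g i) ∧
    Ψ.eval 0 < 0 ∧
    (∀ v : H³, barrierValue Ψ v ≤ η → ‖v‖ ^ 2 ≤ E) ∧
    ∀ v : H³, Torus.eGradNormSq ((v : L2³) : 𝕋³ → E³) ≠ ⊤ → |barrierValue Ψ v| ≤ η →
      barrierGenerator ν f Ψ v ≤ 0

/-- CANDIDATE REPAIRED CRUX, resolution-indexed: BARRIER at resolution `ν^{-βb}` + floor at resolution `ν^{-β}` on the
trapped ball (`βb = β = 3/4`: **KolmogorovTrapFloorPair**, the recommended successor; `βb = 1/2` the daring Taylor barrier). -/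
def TrapFloorPairAt (βb β : ℝ) : Prop :=
  ∃ f : 𝕋³ → E³, Torus.IsSmooth f ∧ Torus.IsDivFree f ∧ Torus.HasZeroMean f ∧
    ∃ (ε₀ E η C Θ ν₀ : ℝ), 0 < ε₀ ∧ 0 < η ∧ 0 < ν₀ ∧
      ∀ ν : ℝ, 0 < ν → ν < ν₀ → BarrierClauseAt βb ν E η C f ∧ FloorClauseAt β ν ε₀ E C Θ f

/-- The recommended successor of the refuted crux: both clauses at Kolmogorov resolution. -/
def KolmogorovTrapFloorPair : Prop := TrapFloorPairAt (3 / 4) (3 / 4)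

/-- Same assembly at every resolution exponent (the transfer lemmas never look at the band limit). -/
theorem trapAssemblyAt_holds (βb β : ℝ) :
    TrapFloorPairAt βb β → BarrierTransfer → FloorTransferBall → ZeroDatumLift → MeanEnergyOfSup →
      _root_.AnomalousDissipation := by
  intro hP hB hF hZ hM
  obtain ⟨f, hfs, hfd, hfz, ε₀, E, η, C, Θ, ν₀, hε₀, hη, hν₀, hcert⟩ := hP
  have key : ∀ j : ℕ, ∃ u : ℝ → 𝕋³ → E³,
      Torus.IsGlobalLerayHopf (ν₀ / ((j : ℝ) + 2)) (fun _ => f) 0 u ∧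
        ε₀ ≤ meanDissipation (ν₀ / ((j : ℝ) + 2)) u ∧ meanEnergy u ≤ E := by
    intro j
    have hj : (0 : ℝ) < (j : ℝ) + 2 := by positivity
    have hνpos : 0 < ν₀ / ((j : ℝ) + 2) := div_pos hν₀ hj
    have hνlt : ν₀ / ((j : ℝ) + 2) < ν₀ := by
      rw [div_lt_iff₀ hj]; nlinarith
    obtain ⟨⟨N, Ψ, -, -, hΨ0, hsub, hgen⟩, ⟨N₁, Φ₁, θ₁, -, -, -, hθ₁, hfloor⟩⟩ := hcert _ hνpos hνlt
    obtain ⟨u, U, hLH, hU⟩ := hZ _ f hνpos hfs hfz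
    have hball : ∀ t, 0 ≤ t → ‖U t‖ ^ 2 ≤ E :=
      hB _ η E f u U Ψ hνpos hη hfs hΨ0 hsub hgen hLH hU
    have hE0 : 0 ≤ E := le_trans (sq_nonneg _) (hball 0 le_rfl)
    exact ⟨u, hLH, hF _ ε₀ E θ₁ f 0 u U Φ₁ hνpos hfs hθ₁ hfloor hLH hU hball, hM E u U hE0 hU hball⟩
  choose u hu using key
  refine ⟨f, hfs, hfd, hfz, fun j => ν₀ / ((j : ℝ) + 2), fun _ => 0, u, fun j => div_pos hν₀ (by positivity), ?_,
    fun j => (hu j).1, ⟨E, fun j => (hu j).2.2⟩, ε₀, hε₀, fun j => (hu j).2.1⟩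
  have h1 : Filter.Tendsto (fun j : ℕ => ((j : ℝ) + 2)⁻¹) Filter.atTop (nhds 0) :=
    tendsto_inv_atTop_zero.comp
      (Filter.tendsto_atTop_add_const_right Filter.atTop (2 : ℝ) tendsto_natCast_atTop_atTop)
  have h2 : Filter.Tendsto (fun j : ℕ => ν₀ * ((j : ℝ) + 2)⁻¹) Filter.atTop (nhds (ν₀ * 0)) := h1.const_mul ν₀
  rw [mul_zero] at h2
  simpa [div_eq_mul_inv] using h2

/-- The Taylor case is `β = 1/2` (bookkeeping). -/
theorem floorClauseAt_half_iff (ν ε₀ E C Θ : ℝ) (f : 𝕋³ → E³) :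
    FloorClauseAt (1 / 2) ν ε₀ E C Θ f ↔ FloorClause ν ε₀ E C Θ f := by
  unfold FloorClauseAt FloorClause
  constructor <;> rintro ⟨N, Φ₁, θ₁, hN, h⟩ <;> refine ⟨N, Φ₁, θ₁, ?_, h⟩ <;> simpa using hN

/-- The Kolmogorov successor decides the summit given the four provable-now supports. -/
theorem kolmogorovTrapAssembly_holds :
    KolmogorovTrapFloorPair → BarrierTransfer → FloorTransferBall → ZeroDatumLift → MeanEnergyOfSup →
      _root_.AnomalousDissipation :=
  trapAssemblyAt_holds (3 / 4) (3 / 4)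

/-! ### Card `odd-clock-cascade`: parity of floor certificates -/

/-- The even-core inequality left after averaging a floor certificate over `u ↦ −u`: with
`W_e(u) = ½(Φ'(u) + Φ'(−u))` (the differential of the ODD part of the profile) and `W_o(u) = ½(Φ'(u) − Φ'(−u))`
(differential of the EVEN part), `ε₀ ≤ (1 − 2θ₁)D(u) + (f, W_e) + ∫(u⊗u):∇W_e + ν(u, ΔW_o)`.  The injection channel
`2θ₁(u,f)`, the sign of vortex stretching and every other time-odd quantity have cancelled: a pointwise floor is a
statement about the reversible field `f − B(u,u)` priced by viscosity. -/
def EvenCoreFloor (ν ε₀ E θ₁ : ℝ) (f : 𝕋³ → E³) (Φ₁ : Torus.CylindricalTest (Fin 3)) : Prop :=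
  ∀ v : H³, let vf : 𝕋³ → E³ := ((v : L2³) : 𝕋³ → E³)
    let D : ℝ := ν * (Torus.eGradNormSq vf).toReal
    let We : 𝕋³ → E³ := fun x => (1 / 2 : ℝ) • (Φ₁.grad v x + Φ₁.grad (-v) x)
    let Wo : 𝕋³ → E³ := fun x => (1 / 2 : ℝ) • (Φ₁.grad v x - Φ₁.grad (-v) x)
    Torus.eGradNormSq vf ≠ ⊤ → ‖v‖ ^ 2 ≤ E →
      ε₀ ≤ (1 - 2 * θ₁) * D + (∫ x, inner ℝ (f x) (We x)) + Torus.inertialPairing (v : L2³) We +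
        ν * ∫ x, inner ℝ (vf x) (Torus.laplacian Wo x)

/-- FIRST LEMMA of card `odd-clock-cascade` (provable-now candidate, pure bookkeeping: the floor at `v` and at `−v`,
`eGradNormSq`/norm are even, `pairing`/`nsGeneratorPairing` are linear in the test field and
`nsGeneratorPairing ν f (−v) w = (f,w) − ν(v,Δw) + ∫(v⊗v):∇w`). -/
def floor_parity : Prop :=
  ∀ (ν ε₀ E C Θ : ℝ) (f : 𝕋³ → E³), 0 < ν → Torus.IsSmooth f →
    ∀ (N : ℕ) (Φ₁ : Torus.CylindricalTest (Fin 3)) (θ₁ : ℝ),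
      (∀ i, Torus.fourierTruncate N (Φ₁.g i) = Φ₁.g i) → θ₁ ≤ 0 →
      (∀ v : H³, let vf : 𝕋³ → E³ := ((v : L2³) : 𝕋³ → E³)
        let D : ℝ := ν * (Torus.eGradNormSq vf).toReal
        let P : ℝ := Torus.pairing (v : L2³) f - D
        Torus.eGradNormSq vf ≠ ⊤ → ‖v‖ ^ 2 ≤ E →
          ε₀ ≤ D + Torus.nsGeneratorPairing ν f v (Φ₁.grad v) + 2 * θ₁ * P) →
      EvenCoreFloor ν ε₀ E θ₁ f Φ₁

end Summit.AnomalousDissipation.AnomalousDissipation.Cruxes.TaylorCertificatePair.TrappingBarrier
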